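import Summits.QuantumFields.YangMills.Theorems.UnitScaleTiltProp7TrueLinSourcedDefect
import Summits.QuantumFields.YangMills.Theorems.UnitScaleTiltProp7TrueLinSourcedDefectL1Rows
import HarnessLib

/-!
# Route `UnitScaleTilt`, crux K1 «MinimiserStabilityRegPr» (stmt-QuantumFields-19200), route-R [RP] curved, row (n3) N3b, file 1b —
# THE SOURCED STRUCTURE RECURSION IN `ℓ¹`: for `D_{j+1} = T_jD_j + R_j` along the background tower (ANY initial field `D_0`),
# `‖D_k‖_{ℓ¹} ≤ E_k·(ρ₁ᵏ‖D_0‖_{ℓ¹} + Σ_{j<k} ρ₁^{k−1−j}‖R_j‖_{ℓ¹}) + 2d·(d+2)L·Σ_{j<k} E_j·(ρ₁ʲ‖D_0‖_{ℓ¹} + Σ_{i<j} ρ₁^{j−1−i}‖R_i‖_{ℓ¹})`,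
# `ρ₁ = L^{1−d}` (`= L⁻²` at d = 3), `E_j = exp((κ₁/ρ₁)Σ_{i<j}a_i)`, `κ₁ = 159·(d+2)L·2d` — hence k-UNIFORMLY `‖D_k‖_{ℓ¹} ≤ (1 + 4d(d+2)L)·E_k·(‖D_0‖_{ℓ¹} + Σ_{j<k}‖R_j‖_{ℓ¹})`

Cell `ym3-torus`, D-0154 (3c) extra-width seat `ym-routeR-w6` (gen 3); the `ℓ¹` TWIN of ★routeR-w3's ✓ `…Prop7TrueLinSourcedDefect` (file A2, `ℓ²`), sequel of
file 1a ✓∕⧗ `…Prop7TrueLinSourcedDefectL1Rows` (the one-level `ℓ¹` rows and the real bookkeeping), written for row (n3) N3b of the route-R door (★routeR-w1 g2's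
located hand-over 2026-08-28 12:53Z).  THEOREMS ONLY (0 `def`, 0 `sorry`); `--supports stmt-QuantumFields-19200`, count-neutral.  YM₃ on T³ is a ladder rung (R3), not
the Clay problem; nothing here claims the stub, the crux, d = 4 or the mass gap.

THE POINT.  The door's third supplier (★p1 g13 12:50Z (c), ★w4-19200 g4's JOINT ROW) pairs the multiplier `λ` of ✓ `…Prop7FirstVariationExactPairing` ∕
`…MultiplierBound` (`‖λ‖_∞ ≤ 2ε₀ℓ⁻¹`) with the `ℓ¹` size of the accumulated two-point remainder `r = D_k` of the nonlinear (0.4)-fibre; so the tower transport of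
the per-level remainders (N3a ✓ `…Prop7FibreRemainderL1Level`: `‖R_j‖_{ℓ¹} ≤ 234000·L⁵·Σ_b‖Y_j b‖²` at d = 3) must be done in `ℓ¹`, k-uniformly.  A plain operator
norm `‖T_j‖_{ℓ¹→ℓ¹} ≈ 2d + L^{1−d}` exponentiates in `k`; the structure split of file A1 ✓ `…TrueLinSourcedStructure` (`D_j = G^D_j + P_{Ū₀^{(j)}}Λ^D_j`,
`G^D_{j+1} = LINE_j G^D_j + Def_j G^D_j + R_j`, `Λ^D_{j+1} = CM_j G^D_j + Λ^D_j∘emb`) does not: by file 1a `‖LINE_j‖_{ℓ¹→ℓ¹} ≤ L^{1−d}`, `‖Def_j‖_{ℓ¹→ℓ¹} ≤ 159a_j(d+2)L·2d`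
(no volume factor), `‖CM_j‖ ≤ (d+2)L` in `ℓ¹`, and `Λ^D` accumulates additively along the injective `emb` (§4) — so `g_{j+1} ≤ (ρ₁ + κ₁a_j)g_j + r_j` for the reduced
family and the title follows (§5).  The INITIAL VALUE is kept because the door reads `r(D) = −Q^{(k)}(iD)` through the family `D′_j := Y_j − Q^{(j)}(iD)` with
`D′_0 = e^{iD} − 1 − iD ≠ 0` and the SAME sources; with `D_0 = 0` the statements are the literal `ℓ¹` twins of A2's.

WHAT IS PROVED (ns `…Theorems.Prop7TrueLinSourcedDefectL1`; `SU`-type background of any rank `n`, any `P`; `T_j`, `CM` WRITTEN OUT as in A1∕A2).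
* §4 ★ `sum_norm_sourcedReduced_succ_le` (the one-step row, for consumers with state-dependent sources), ★ `sum_norm_sourcedReduced_le` (the reduced family in `ℓ¹`, any `G 0`), `sum_norm_le_sum_levels` (`ℓ¹` propagation along `emb`), ★ `sum_norm_sourcedGauge_le`
  (the coarse gauge function in `ℓ¹`; no plaquette hypothesis needed, unlike `ℓ²`).
* §5 ★★ `sum_norm_sourced_le` (the title, geometric weights displayed), ★★ `sum_norm_sourced_le_uniform` (k-uniform constants `(1 + 4d(d+2)L)·E_k`, `2 ≤ d`).
HONEST SCOPE.  Bookkeeping over landed bricks (file 1a, ✓ A1 structure, ✓ `Prop7CovIterLambdaBound.sum_comp_emb_le`); nothing of [Balaban1984PropagatorsI] ∕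
[Balaban1985Averaging] is asserted beyond the cited tree theorems.  The instantiation at the nonlinear fibre remainders (`R_j = Y_{j+1} − T_jY_j`, N3a's row) and the
identification `r(D) = D′_k` on the fibre are the sequel (N3b file 2); the joint-currency gain `ℓ⁻¹` for curl-free directions is NOT here (LEAD's comb-strip brick).

References: T. Bałaban, CMP 95 (1984) 17–40 [Balaban1984PropagatorsI] ((1.11), (1.18)–(1.20) pp.19–20); CMP 98 (1985) 17–51 [Balaban1985Averaging] (Prop. 3
(124)–(126) p.36); CMP 102 (1985) 277–309 [Balaban1985Variational] (Prop. 7 p.299); CMP 109 (1987) 249–301 [Balaban1987RG1] ((0.3)–(0.4) pp.252–253).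
-/

set_option autoImplicit false

noncomputable section

open scoped BigOperators Matrix.Norms.L2Operator

namespace Summit.QuantumFields.YangMills.Theorems.Prop7TrueLinSourcedDefectL1

open Literature.MathematicalPhysics.QuantumFieldTheory.Balaban1983to89
open Finset T4Continuum BlockAveraging AveragingRT ExpMeanLog BlockAveragingEMLLinearised BlockAveragingEMLLinearisedBackground BlockAveragingEMLProp2
open Summit.QuantumFields.YangMills.Theorems.Prop7TrueLinSourcedDefectL1Rows (sum_norm_line_le sum_norm_defect_le sum_norm_covCombMean_le
  sourced_recursion_bound_init geom_weights_uniform)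
open Summit.QuantumFields.YangMills.Theorems.Prop7TrueLinSourcedStructure (norm_le_of_sourced_structure)
open Summit.QuantumFields.YangMills.Theorems.Prop7CovIterLambdaBound (sum_comp_emb_le)
open Summit.QuantumFields.YangMills.Theorems.Prop7PinnedFlatCoercivity (sum_pbond_tgt_add_src)

variable {P : Params} {n : Type*} [Fintype n] [DecidableEq n] [Nonempty n]

/-! ## §4 ★ The sourced reduced family and the coarse gauge function in `ℓ¹` -/

section Sourced

variable (U₀ : GaugeField P 0 (Matrix.specialUnitaryGroup n ℂ)) (R : (k : ℕ) → PBond P (k + 1) → Matrix n n ℂ)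
  (G : (k : ℕ) → PBond P k → Matrix n n ℂ)
  (hGs : ∀ (k : ℕ) (c : PBond P (k + 1)), G (k + 1) c
      = (fderiv ℂ (eml : (Idx P → Matrix n n ℂ) → Matrix n n ℂ)
            (fun i => ((loopHol (Averaging.iter (fun i => blockAvg (P := P) (j := i) (expMeanLogSU (n := n))) k U₀) c i : Matrix.specialUnitaryGroup n ℂ) : Matrix n n ℂ))
            (fun i => covWalkSum (Averaging.iter (fun i => blockAvg (P := P) (j := i) (expMeanLogSU (n := n))) k U₀) (G k) (walk (emb c.src) (loopWord P.L c.dir (off i.1) i.2.1 i.2.2))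
              * ((loopHol (Averaging.iter (fun i => blockAvg (P := P) (j := i) (expMeanLogSU (n := n))) k U₀) c i : Matrix.specialUnitaryGroup n ℂ) : Matrix n n ℂ))
            * star ((corr (expMeanLogSU (n := n)) (Averaging.iter (fun i => blockAvg (P := P) (j := i) (expMeanLogSU (n := n))) k U₀) c : Matrix.specialUnitaryGroup n ℂ) : Matrix n n ℂ)
          + ((corr (expMeanLogSU (n := n)) (Averaging.iter (fun i => blockAvg (P := P) (j := i) (expMeanLogSU (n := n))) k U₀) c : Matrix.specialUnitaryGroup n ℂ) : Matrix n n ℂ)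
            * covWalkSum (Averaging.iter (fun i => blockAvg (P := P) (j := i) (expMeanLogSU (n := n))) k U₀) (G k) (walk (emb c.src) (List.replicate P.L (c.dir, true)))
            * star ((corr (expMeanLogSU (n := n)) (Averaging.iter (fun i => blockAvg (P := P) (j := i) (expMeanLogSU (n := n))) k U₀) c : Matrix.specialUnitaryGroup n ℂ) : Matrix n n ℂ))
        - ((((Fintype.card (Idx P) : ℂ))⁻¹ • ∑ i : Idx P,
              covWalkSum (Averaging.iter (fun i => blockAvg (P := P) (j := i) (expMeanLogSU (n := n))) k U₀) (G k) (walk (emb c.src) (stairWord i.2.1 (off i.1))))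
            - ((Averaging.iter (fun i => blockAvg (P := P) (j := i) (expMeanLogSU (n := n))) (k + 1) U₀ c : Matrix.specialUnitaryGroup n ℂ) : Matrix n n ℂ)
              * (((Fintype.card (Idx P) : ℂ))⁻¹ • ∑ i : Idx P,
              covWalkSum (Averaging.iter (fun i => blockAvg (P := P) (j := i) (expMeanLogSU (n := n))) k U₀) (G k) (walk (emb c.tgt) (stairWord i.2.1 (off i.1))))
              * star ((Averaging.iter (fun i => blockAvg (P := P) (j := i) (expMeanLogSU (n := n))) (k + 1) U₀ c : Matrix.specialUnitaryGroup n ℂ) : Matrix n n ℂ))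
        + R k c)

include hGs in
/-- ★ **THE ONE-STEP `ℓ¹` ROW OF THE SOURCED REDUCED FAMILY**: at a level `j + 1 ≤ m + K` whose background loop variables are within `α ≤ 1/24` (`0 ≤ α < δ_N`) of `1`,
`Σ_c‖G (j+1) c‖ ≤ ((L^d)⁻¹L + 159·(d+2)L·2d·α)·Σ_c‖G j c‖ + Σ_c‖R j c‖` — the decomposition `G_{j+1} = Def_jG_j + LINE_jG_j + R_j` and the two one-level rows of file 1a
(exposed separately so that consumers with STATE-DEPENDENT sources can run their own recursion). [cite: Balaban1985Averaging, Prop. 3 (124)-(126) p.36] -/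
theorem sum_norm_sourcedReduced_succ_le {j : ℕ} (hj1 : j + 1 ≤ P.m + P.K) {α : ℝ} (hα0 : 0 ≤ α)
    (hα : ∀ (c : PBond P (j + 1)) (i : Idx P),
        dist1 (loopHol (Averaging.iter (fun i => blockAvg (P := P) (j := i) (expMeanLogSU (n := n))) j U₀) c i) ≤ α)
    (hα24 : α ≤ 1 / 24) (hαN : α < deltaSU n) :
    ∑ c : PBond P (j + 1), ‖G (j + 1) c‖
      ≤ ((((P.L : ℝ) ^ P.d)⁻¹ * (P.L : ℝ)) + (159 * (((P.d + 2) * P.L : ℕ) : ℝ) * (2 * P.d)) * α) * ∑ c : PBond P j, ‖G j c‖ + ∑ c : PBond P (j + 1), ‖R j c‖ := by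
  set V := Averaging.iter (fun i => blockAvg (P := P) (j := i) (expMeanLogSU (n := n))) j U₀ with hV
  set D : PBond P (j + 1) → Matrix n n ℂ := fun c =>
    (fderiv ℂ (eml : (Idx P → Matrix n n ℂ) → Matrix n n ℂ)
          (fun i => ((loopHol V c i : Matrix.specialUnitaryGroup n ℂ) : Matrix n n ℂ))
          (fun i => covWalkSum V (G j) (walk (emb c.src) (loopWord P.L c.dir (off i.1) i.2.1 i.2.2))
            * ((loopHol V c i : Matrix.specialUnitaryGroup n ℂ) : Matrix n n ℂ))
          * star ((corr (expMeanLogSU (n := n)) V c : Matrix.specialUnitaryGroup n ℂ) : Matrix n n ℂ)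
        + ((corr (expMeanLogSU (n := n)) V c : Matrix.specialUnitaryGroup n ℂ) : Matrix n n ℂ)
          * covWalkSum V (G j) (walk (emb c.src) (List.replicate P.L (c.dir, true)))
          * star ((corr (expMeanLogSU (n := n)) V c : Matrix.specialUnitaryGroup n ℂ) : Matrix n n ℂ))
    - ((((Fintype.card (Idx P) : ℂ))⁻¹ • ∑ i : Idx P,
            covWalkSum V (G j) (walk (emb c.src) (stairWord i.2.1 (off i.1))))
        - ((avgFun (expMeanLogSU (n := n)) V c : Matrix.specialUnitaryGroup n ℂ) : Matrix n n ℂ)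
            * (((Fintype.card (Idx P) : ℂ))⁻¹ • ∑ i : Idx P,
            covWalkSum V (G j) (walk (emb c.tgt) (stairWord i.2.1 (off i.1))))
            * star ((avgFun (expMeanLogSU (n := n)) V c : Matrix.specialUnitaryGroup n ℂ) : Matrix n n ℂ))
    - (((Fintype.card (Idx P) : ℂ))⁻¹ • ∑ i : Idx P,
        ((holAt V (walk (emb c.src) (stairWord i.2.1 (off i.1))) : Matrix.specialUnitaryGroup n ℂ) : Matrix n n ℂ) *
          covWalkSum V (G j) (walk (walkEnd (emb c.src) (stairWord i.2.1 (off i.1))) (List.replicate P.L (c.dir, true))) *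
        star ((holAt V (walk (emb c.src) (stairWord i.2.1 (off i.1))) : Matrix.specialUnitaryGroup n ℂ) : Matrix n n ℂ)) with hD
  set LG : PBond P (j + 1) → Matrix n n ℂ := fun c => (((Fintype.card (Idx P) : ℂ))⁻¹ • ∑ i : Idx P,
        ((holAt V (walk (emb c.src) (stairWord i.2.1 (off i.1))) : Matrix.specialUnitaryGroup n ℂ) : Matrix n n ℂ) *
          covWalkSum V (G j) (walk (walkEnd (emb c.src) (stairWord i.2.1 (off i.1))) (List.replicate P.L (c.dir, true))) *
        star ((holAt V (walk (emb c.src) (stairWord i.2.1 (off i.1))) : Matrix.specialUnitaryGroup n ℂ) : Matrix n n ℂ)) with hLG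
  have hiter : Averaging.iter (fun i => blockAvg (P := P) (j := i) (expMeanLogSU (n := n))) (j + 1) U₀ = avgFun (expMeanLogSU (n := n)) V := rfl
  have hdec : ∀ c, G (j + 1) c = (D c + LG c) + R j c := by
    intro c
    rw [hGs, hiter]
    simp only [hD, hLG]
    abel
  have hDrow : ∑ c, ‖D c‖ ≤ 159 * α * (((P.d + 2) * P.L : ℕ) : ℝ) * (2 * P.d) * ∑ c, ‖G j c‖ := by
    have h := sum_norm_defect_le hj1 V (G j) hα0 hα hα24 hαN
    simpa only [hD] using h
  have hLGrow : ∑ c, ‖LG c‖ ≤ ((P.L : ℝ) ^ P.d)⁻¹ * (P.L : ℝ) * ∑ c, ‖G j c‖ := by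
    have h := sum_norm_line_le hj1 V (G j)
    simpa only [hLG] using h
  calc ∑ c, ‖G (j + 1) c‖ = ∑ c, ‖(D c + LG c) + R j c‖ := by simp only [hdec]
    _ ≤ ∑ c, (‖D c‖ + ‖LG c‖ + ‖R j c‖) :=
        Finset.sum_le_sum fun c _ => (norm_add_le _ _).trans (add_le_add (norm_add_le _ _) le_rfl)
    _ = ∑ c, ‖D c‖ + ∑ c, ‖LG c‖ + ∑ c, ‖R j c‖ := by rw [Finset.sum_add_distrib, Finset.sum_add_distrib]
    _ ≤ 159 * α * (((P.d + 2) * P.L : ℕ) : ℝ) * (2 * P.d) * ∑ c, ‖G j c‖ + ((P.L : ℝ) ^ P.d)⁻¹ * (P.L : ℝ) * ∑ c, ‖G j c‖ + ∑ c, ‖R j c‖ :=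
        add_le_add (add_le_add hDrow hLGrow) le_rfl
    _ = _ := by ring

include hGs in
/-- ★ **THE SOURCED REDUCED FAMILY IN `ℓ¹`** (ANY initial value `G 0`): along the tower `Ū₀^{(j)}` in the standing range `k ≤ m + K`, with per-level loop sizes
`dist1(W^{(j)}_i(c)) ≤ a j ≤ 1/24`, `0 ≤ a j < δ_N` (`j < k`), the sourced reduced family at the covariant comb mean obeys, with `ρ₁ = (L^d)⁻¹L`, `κ₁ = 159·(d+2)L·2d`,
`Σ_c‖G k c‖ ≤ exp((κ₁/ρ₁)Σ_{j<k} a j)·(ρ₁ᵏ·Σ_b‖G 0 b‖ + Σ_{j<k} ρ₁^{k−1−j}·Σ_c‖R j c‖)` — per level `g_{j+1} ≤ (ρ₁ + κ₁a_j)g_j + r_j` by §1.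
[cite: Balaban1984PropagatorsI, (1.18)-(1.20) pp.19-20; Balaban1985Averaging, Prop. 3 (124)-(126) p.36] -/
theorem sum_norm_sourcedReduced_le (a : ℕ → ℝ) (ha0 : ∀ j, 0 ≤ a j) {k : ℕ} (hk : k ≤ P.m + P.K)
    (hα : ∀ j < k, ∀ (c : PBond P (j + 1)) (i : Idx P),
        dist1 (loopHol (Averaging.iter (fun i => blockAvg (P := P) (j := i) (expMeanLogSU (n := n))) j U₀) c i) ≤ a j)
    (ha24 : ∀ j < k, a j ≤ 1 / 24) (haN : ∀ j < k, a j < deltaSU n) :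
    ∑ c : PBond P k, ‖G k c‖
      ≤ Real.exp ((159 * (((P.d + 2) * P.L : ℕ) : ℝ) * (2 * P.d)) / (((P.L : ℝ) ^ P.d)⁻¹ * (P.L : ℝ)) * ∑ i ∈ Finset.range k, a i)
        * ((((P.L : ℝ) ^ P.d)⁻¹ * (P.L : ℝ)) ^ k * ∑ b : PBond P 0, ‖G 0 b‖ + ∑ j ∈ Finset.range k, (((P.L : ℝ) ^ P.d)⁻¹ * (P.L : ℝ)) ^ (k - 1 - j) * ∑ c : PBond P (j + 1), ‖R j c‖) := by
  have hLpos : (0 : ℝ) < (P.L : ℝ) := by exact_mod_cast P.L_pos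
  have hρpos : (0 : ℝ) < (((P.L : ℝ) ^ P.d)⁻¹ * (P.L : ℝ)) := by positivity
  have hκ0 : (0 : ℝ) ≤ (159 * (((P.d + 2) * P.L : ℕ) : ℝ) * (2 * P.d)) := by positivity
  -- the per-level rows `g (j+1) ≤ (ρ₁ + κ₁ a j) g j + r j` (one-step theorem above)
  have hrows : ∀ j < k, ∑ c : PBond P (j + 1), ‖G (j + 1) c‖
      ≤ ((((P.L : ℝ) ^ P.d)⁻¹ * (P.L : ℝ)) + (159 * (((P.d + 2) * P.L : ℕ) : ℝ) * (2 * P.d)) * a j) * ∑ c : PBond P j, ‖G j c‖ + ∑ c : PBond P (j + 1), ‖R j c‖ :=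
    fun j hj => sum_norm_sourcedReduced_succ_le U₀ R G hGs (by omega) (ha0 j) (hα j hj) (ha24 j hj) (haN j hj)
  exact sourced_recursion_bound_init hρpos hκ0 a (fun j => ∑ c : PBond P j, ‖G j c‖) (fun j => ∑ c : PBond P (j + 1), ‖R j c‖) ha0
    (fun j => Finset.sum_nonneg fun c _ => norm_nonneg _) (fun j => Finset.sum_nonneg fun c _ => norm_nonneg _) k hrows

end Sourced

section Levels

variable {M : Type*} [SeminormedAddCommGroup M]

omit [Fintype n] [DecidableEq n] [Nonempty n] in
/-- **PROPAGATION IN `ℓ¹` — THE LEVELS ADD**: if `Λ_0 = 0` and `‖Λ_{j+1}(z)‖ ≤ t_j(z) + ‖Λ_j(emb z)‖`, then for `k ≤ m + K`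
`Σ_{y ∈ T^{(k)}} ‖Λ_k(y)‖ ≤ Σ_{j<k} Σ_{z ∈ T^{(j+1)}} t_j(z)` (`emb` is injective in the standing range, ✓ `sum_comp_emb_le`; `ℓ¹` twin of
✓ `Prop7CovIterLambdaBound.sqrt_sum_normSq_le_sum_levels`). [cite: Balaban1984PropagatorsI, (1.18)-(1.20) pp.19-20] -/
theorem sum_norm_le_sum_levels (Λ : (k : ℕ) → Site P k → M) (hΛ0 : ∀ y, Λ 0 y = 0) (t : (k : ℕ) → Site P (k + 1) → ℝ)
    (hΛs : ∀ (k : ℕ) (z : Site P (k + 1)), ‖Λ (k + 1) z‖ ≤ t k z + ‖Λ k (emb z)‖) :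
    ∀ k : ℕ, k ≤ P.m + P.K → ∑ y : Site P k, ‖Λ k y‖ ≤ ∑ j ∈ Finset.range k, ∑ z : Site P (j + 1), t j z := by
  intro k
  induction k with
  | zero => intro _; simp [hΛ0]
  | succ k ih =>
    intro hk
    rw [Finset.sum_range_succ]
    have hk' : k ≤ P.m + P.K := Nat.le_of_succ_le hk
    have h1 : ∑ z : Site P (k + 1), ‖Λ (k + 1) z‖ ≤ ∑ z : Site P (k + 1), (t k z + ‖Λ k (emb z)‖) :=
      Finset.sum_le_sum fun z _ => hΛs k z
    have h3 : ∑ z : Site P (k + 1), ‖Λ k (emb z)‖ ≤ ∑ y : Site P k, ‖Λ k y‖ :=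
      sum_comp_emb_le hk (fun y => ‖Λ k y‖) fun y => norm_nonneg _
    rw [Finset.sum_add_distrib] at h1
    linarith [ih hk']

end Levels

section Gauge

variable (U₀ : GaugeField P 0 (Matrix.specialUnitaryGroup n ℂ)) (G : (k : ℕ) → PBond P k → Matrix n n ℂ) (Λ : (k : ℕ) → Site P k → Matrix n n ℂ)
  (hΛ0 : ∀ y, Λ 0 y = 0)
  (hΛs : ∀ (k : ℕ) (z : Site P (k + 1)), Λ (k + 1) z
    = (((Fintype.card (Idx P) : ℂ))⁻¹ • ∑ i : Idx P,
              covWalkSum (Averaging.iter (fun i => blockAvg (P := P) (j := i) (expMeanLogSU (n := n))) k U₀) (G k) (walk (emb z) (stairWord i.2.1 (off i.1))))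
      + Λ k (emb z))

include hΛ0 hΛs in
/-- ★ **THE COARSE GAUGE FUNCTION IN `ℓ¹`, SOURCE VERSION**: for the recursion of record `Λ_0 = 0`, `Λ_{j+1}(z) = CM_j(G_j)(z) + Λ_j(emb z)` along the tower,
`Σ_y‖Λ_k(y)‖ ≤ Σ_{j<k} (d+2)L·Σ_c‖G_j(c)‖` (`k ≤ m + K`; the levels add, §2 for the comb mean — no plaquette hypothesis and no Poincaré in `ℓ¹`).
[cite: Balaban1984PropagatorsI, (1.18)-(1.20) pp.19-20] -/
theorem sum_norm_sourcedGauge_le {k : ℕ} (hk : k ≤ P.m + P.K) :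
    ∑ y : Site P k, ‖Λ k y‖ ≤ ∑ j ∈ Finset.range k, (((P.d + 2) * P.L : ℕ) : ℝ) * ∑ c : PBond P j, ‖G j c‖ := by
  have ht := Prop7CovIterLambdaBound.norm_le_of_rec_eq Λ (fun j z => (((Fintype.card (Idx P) : ℂ))⁻¹ • ∑ i : Idx P,
              covWalkSum (Averaging.iter (fun i => blockAvg (P := P) (j := i) (expMeanLogSU (n := n))) j U₀) (G j) (walk (emb z) (stairWord i.2.1 (off i.1))))) hΛs
  have hmain := sum_norm_le_sum_levels Λ hΛ0 (fun j z => ‖(((Fintype.card (Idx P) : ℂ))⁻¹ • ∑ i : Idx P,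
              covWalkSum (Averaging.iter (fun i => blockAvg (P := P) (j := i) (expMeanLogSU (n := n))) j U₀) (G j) (walk (emb z) (stairWord i.2.1 (off i.1))))‖) ht k hk
  refine hmain.trans (Finset.sum_le_sum fun j hj => ?_)
  have hjk : j < k := Finset.mem_range.mp hj
  exact sum_norm_covCombMean_le (by omega) _ (G j)

end Gauge

/-! ## §5 ★★ The sourced family in `ℓ¹` -/

section Assembly

variable (U₀ : GaugeField P 0 (Matrix.specialUnitaryGroup n ℂ)) (R : (k : ℕ) → PBond P (k + 1) → Matrix n n ℂ)
  (D : (k : ℕ) → PBond P k → Matrix n n ℂ)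
  (hDs : ∀ (k : ℕ) (c : PBond P (k + 1)), D (k + 1) c = (fderiv ℂ (eml : (Idx P → Matrix n n ℂ) → Matrix n n ℂ)
            (fun i => ((loopHol (Averaging.iter (fun i => blockAvg (P := P) (j := i) (expMeanLogSU (n := n))) k U₀) c i : Matrix.specialUnitaryGroup n ℂ) : Matrix n n ℂ))
            (fun i => covWalkSum (Averaging.iter (fun i => blockAvg (P := P) (j := i) (expMeanLogSU (n := n))) k U₀) (D k) (walk (emb c.src) (loopWord P.L c.dir (off i.1) i.2.1 i.2.2))
              * ((loopHol (Averaging.iter (fun i => blockAvg (P := P) (j := i) (expMeanLogSU (n := n))) k U₀) c i : Matrix.specialUnitaryGroup n ℂ) : Matrix n n ℂ))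
            * star ((corr (expMeanLogSU (n := n)) (Averaging.iter (fun i => blockAvg (P := P) (j := i) (expMeanLogSU (n := n))) k U₀) c : Matrix.specialUnitaryGroup n ℂ) : Matrix n n ℂ)
          + ((corr (expMeanLogSU (n := n)) (Averaging.iter (fun i => blockAvg (P := P) (j := i) (expMeanLogSU (n := n))) k U₀) c : Matrix.specialUnitaryGroup n ℂ) : Matrix n n ℂ)
            * covWalkSum (Averaging.iter (fun i => blockAvg (P := P) (j := i) (expMeanLogSU (n := n))) k U₀) (D k) (walk (emb c.src) (List.replicate P.L (c.dir, true)))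
            * star ((corr (expMeanLogSU (n := n)) (Averaging.iter (fun i => blockAvg (P := P) (j := i) (expMeanLogSU (n := n))) k U₀) c : Matrix.specialUnitaryGroup n ℂ) : Matrix n n ℂ)) + R k c)
  (G : (k : ℕ) → PBond P k → Matrix n n ℂ) (hG0 : ∀ b, G 0 b = D 0 b)
  (hGs : ∀ (k : ℕ) (c : PBond P (k + 1)), G (k + 1) c
      = (fderiv ℂ (eml : (Idx P → Matrix n n ℂ) → Matrix n n ℂ)
            (fun i => ((loopHol (Averaging.iter (fun i => blockAvg (P := P) (j := i) (expMeanLogSU (n := n))) k U₀) c i : Matrix.specialUnitaryGroup n ℂ) : Matrix n n ℂ))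
            (fun i => covWalkSum (Averaging.iter (fun i => blockAvg (P := P) (j := i) (expMeanLogSU (n := n))) k U₀) (G k) (walk (emb c.src) (loopWord P.L c.dir (off i.1) i.2.1 i.2.2))
              * ((loopHol (Averaging.iter (fun i => blockAvg (P := P) (j := i) (expMeanLogSU (n := n))) k U₀) c i : Matrix.specialUnitaryGroup n ℂ) : Matrix n n ℂ))
            * star ((corr (expMeanLogSU (n := n)) (Averaging.iter (fun i => blockAvg (P := P) (j := i) (expMeanLogSU (n := n))) k U₀) c : Matrix.specialUnitaryGroup n ℂ) : Matrix n n ℂ)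
          + ((corr (expMeanLogSU (n := n)) (Averaging.iter (fun i => blockAvg (P := P) (j := i) (expMeanLogSU (n := n))) k U₀) c : Matrix.specialUnitaryGroup n ℂ) : Matrix n n ℂ)
            * covWalkSum (Averaging.iter (fun i => blockAvg (P := P) (j := i) (expMeanLogSU (n := n))) k U₀) (G k) (walk (emb c.src) (List.replicate P.L (c.dir, true)))
            * star ((corr (expMeanLogSU (n := n)) (Averaging.iter (fun i => blockAvg (P := P) (j := i) (expMeanLogSU (n := n))) k U₀) c : Matrix.specialUnitaryGroup n ℂ) : Matrix n n ℂ))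
        - ((((Fintype.card (Idx P) : ℂ))⁻¹ • ∑ i : Idx P,
              covWalkSum (Averaging.iter (fun i => blockAvg (P := P) (j := i) (expMeanLogSU (n := n))) k U₀) (G k) (walk (emb c.src) (stairWord i.2.1 (off i.1))))
            - ((Averaging.iter (fun i => blockAvg (P := P) (j := i) (expMeanLogSU (n := n))) (k + 1) U₀ c : Matrix.specialUnitaryGroup n ℂ) : Matrix n n ℂ)
              * (((Fintype.card (Idx P) : ℂ))⁻¹ • ∑ i : Idx P,
              covWalkSum (Averaging.iter (fun i => blockAvg (P := P) (j := i) (expMeanLogSU (n := n))) k U₀) (G k) (walk (emb c.tgt) (stairWord i.2.1 (off i.1))))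
              * star ((Averaging.iter (fun i => blockAvg (P := P) (j := i) (expMeanLogSU (n := n))) (k + 1) U₀ c : Matrix.specialUnitaryGroup n ℂ) : Matrix n n ℂ))
        + R k c)
  (Λ : (k : ℕ) → Site P k → Matrix n n ℂ) (hΛ0 : ∀ y, Λ 0 y = 0)
  (hΛs : ∀ (k : ℕ) (z : Site P (k + 1)), Λ (k + 1) z
    = (((Fintype.card (Idx P) : ℂ))⁻¹ • ∑ i : Idx P,
              covWalkSum (Averaging.iter (fun i => blockAvg (P := P) (j := i) (expMeanLogSU (n := n))) k U₀) (G k) (walk (emb z) (stairWord i.2.1 (off i.1))))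
      + Λ k (emb z))

include hDs hG0 hGs hΛ0 hΛs in
/-- ★★ **THE SOURCED FAMILY IN `ℓ¹`** (ANY initial field `D_0`).  `D_{j+1} = T_jD_j + R_j` along the tower `Ū₀^{(j)}` (`k ≤ m + K`); `G` (`G_0 = D_0`), `Λ` the
sourced reduced family and the coarse gauge function of record (file A1); per-level loop sizes `dist1(W^{(j)}_i(c)) ≤ a j ≤ 1/24`, `0 ≤ a j < δ_N` (`j < k`).
Then with `ρ₁ = (L^d)⁻¹L`, `κ₁ = 159·(d+2)L·2d`, `E_j = exp((κ₁/ρ₁)Σ_{i<j}a i)`, `g₀ = Σ_b‖D 0 b‖`, `S_j = Σ_{i<j}ρ₁^{j−1−i}Σ_c‖R i c‖`: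
`Σ_c‖D k c‖ ≤ E_k·(ρ₁ᵏg₀ + S_k) + 2d·Σ_{j<k} (d+2)L·(E_j·(ρ₁ʲg₀ + S_j))`.
[cite: Balaban1984PropagatorsI, (1.18)-(1.20) pp.19-20; Balaban1985Averaging, Prop. 3 (124)-(126) p.36] -/
theorem sum_norm_sourced_le (a : ℕ → ℝ) (ha0 : ∀ j, 0 ≤ a j) {k : ℕ} (hk : k ≤ P.m + P.K)
    (hα : ∀ j < k, ∀ (c : PBond P (j + 1)) (i : Idx P),
        dist1 (loopHol (Averaging.iter (fun i => blockAvg (P := P) (j := i) (expMeanLogSU (n := n))) j U₀) c i) ≤ a j)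
    (ha24 : ∀ j < k, a j ≤ 1 / 24) (haN : ∀ j < k, a j < deltaSU n) :
    ∑ c : PBond P k, ‖D k c‖
      ≤ Real.exp ((159 * (((P.d + 2) * P.L : ℕ) : ℝ) * (2 * P.d)) / (((P.L : ℝ) ^ P.d)⁻¹ * (P.L : ℝ)) * ∑ i ∈ Finset.range k, a i) * ((((P.L : ℝ) ^ P.d)⁻¹ * (P.L : ℝ)) ^ k * (∑ b : PBond P 0, ‖D 0 b‖) + (∑ i ∈ Finset.range k, (((P.L : ℝ) ^ P.d)⁻¹ * (P.L : ℝ)) ^ (k - 1 - i) * ∑ c : PBond P (i + 1), ‖R i c‖))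
        + 2 * P.d * ∑ j ∈ Finset.range k, (((P.d + 2) * P.L : ℕ) : ℝ)
            * (Real.exp ((159 * (((P.d + 2) * P.L : ℕ) : ℝ) * (2 * P.d)) / (((P.L : ℝ) ^ P.d)⁻¹ * (P.L : ℝ)) * ∑ i ∈ Finset.range j, a i) * ((((P.L : ℝ) ^ P.d)⁻¹ * (P.L : ℝ)) ^ j * (∑ b : PBond P 0, ‖D 0 b‖) + (∑ i ∈ Finset.range j, (((P.L : ℝ) ^ P.d)⁻¹ * (P.L : ℝ)) ^ (j - 1 - i) * ∑ c : PBond P (i + 1), ‖R i c‖))) := by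
  -- the (0.4) guards from the loop sizes
  have hg : ∀ j < k, ∀ (c : PBond P (j + 1)) (i : Idx P),
      dist1 (loopHol (Averaging.iter (fun i => blockAvg (P := P) (j := i) (expMeanLogSU (n := n))) j U₀) c i) < deltaSU n :=
    fun j hj c i => (hα j hj c i).trans_lt (haN j hj)
  -- pointwise split
  have hpt : ∀ c : PBond P k, ‖D k c‖ ≤ ‖G k c‖ + (‖Λ k c.tgt‖ + ‖Λ k c.src‖) := fun c => by
    have h := norm_le_of_sourced_structure U₀ D R hDs
      (fun k Gk z => ((Fintype.card (Idx P) : ℂ))⁻¹ • ∑ i : Idx P,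
        covWalkSum (Averaging.iter (fun i => blockAvg (P := P) (j := i) (expMeanLogSU (n := n))) k U₀) Gk (walk (emb z) (stairWord i.2.1 (off i.1))))
      G Λ hG0 hΛ0 hΛs hGs hg c
    linarith
  have h1 : ∑ c : PBond P k, ‖D k c‖ ≤ ∑ c : PBond P k, ‖G k c‖ + 2 * P.d * ∑ y : Site P k, ‖Λ k y‖ := by
    calc ∑ c : PBond P k, ‖D k c‖ ≤ ∑ c : PBond P k, (‖G k c‖ + (‖Λ k c.tgt‖ + ‖Λ k c.src‖)) := Finset.sum_le_sum fun c _ => hpt c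
      _ = ∑ c : PBond P k, ‖G k c‖ + 2 * P.d * ∑ y : Site P k, ‖Λ k y‖ := by
          rw [Finset.sum_add_distrib, sum_pbond_tgt_add_src (fun y => ‖Λ k y‖)]
  -- the reduced family at level `k` and at the levels `j < k`
  have hG0sum : ∑ b : PBond P 0, ‖G 0 b‖ = (∑ b : PBond P 0, ‖D 0 b‖) := Finset.sum_congr rfl fun b _ => by rw [hG0]
  have hG := sum_norm_sourcedReduced_le U₀ R G hGs a ha0 hk hα ha24 haN
  rw [hG0sum] at hG
  have hGj : ∀ j ∈ Finset.range k, ∑ c : PBond P j, ‖G j c‖ ≤ Real.exp ((159 * (((P.d + 2) * P.L : ℕ) : ℝ) * (2 * P.d)) / (((P.L : ℝ) ^ P.d)⁻¹ * (P.L : ℝ)) * ∑ i ∈ Finset.range j, a i) * ((((P.L : ℝ) ^ P.d)⁻¹ * (P.L : ℝ)) ^ j * (∑ b : PBond P 0, ‖D 0 b‖) + (∑ i ∈ Finset.range j, (((P.L : ℝ) ^ P.d)⁻¹ * (P.L : ℝ)) ^ (j - 1 - i) * ∑ c : PBond P (i + 1), ‖R i c‖)) := by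
    intro j hj
    have hjk := Finset.mem_range.mp hj
    have h := sum_norm_sourcedReduced_le U₀ R G hGs a ha0 (hjk.le.trans hk) (fun i hi => hα i (hi.trans hjk))
      (fun i hi => ha24 i (hi.trans hjk)) (fun i hi => haN i (hi.trans hjk))
    rw [hG0sum] at h
    exact h
  -- the coarse gauge function
  have hΛ := sum_norm_sourcedGauge_le U₀ G Λ hΛ0 hΛs hk
  have hC0 : (0 : ℝ) ≤ (((P.d + 2) * P.L : ℕ) : ℝ) := Nat.cast_nonneg _
  have hΛ' : ∑ y : Site P k, ‖Λ k y‖ ≤ ∑ j ∈ Finset.range k, (((P.d + 2) * P.L : ℕ) : ℝ) * (Real.exp ((159 * (((P.d + 2) * P.L : ℕ) : ℝ) * (2 * P.d)) / (((P.L : ℝ) ^ P.d)⁻¹ * (P.L : ℝ)) * ∑ i ∈ Finset.range j, a i) * ((((P.L : ℝ) ^ P.d)⁻¹ * (P.L : ℝ)) ^ j * (∑ b : PBond P 0, ‖D 0 b‖) + (∑ i ∈ Finset.range j, (((P.L : ℝ) ^ P.d)⁻¹ * (P.L : ℝ)) ^ (j - 1 - i) * ∑ c : PBond P (i + 1), ‖R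 i c‖))) :=
    hΛ.trans (Finset.sum_le_sum fun j hj => mul_le_mul_of_nonneg_left (hGj j hj) hC0)
  have hd0 : (0 : ℝ) ≤ 2 * P.d := by positivity
  have := mul_le_mul_of_nonneg_left hΛ' hd0
  linarith [h1, hG, this]

include hDs hG0 hGs hΛ0 hΛs in
/-- ★★ **THE SOURCED FAMILY IN `ℓ¹`, k-UNIFORM CONSTANTS** (`2 ≤ d`, so that `ρ₁ = L^{1−d} ≤ 1/2` in the standing range `1 < L`): under the hypotheses of
★★ `sum_norm_sourced_le`,  `Σ_c‖D k c‖ ≤ (1 + 4d·(d+2)L)·exp((κ₁/ρ₁)Σ_{j<k}a j)·(Σ_b‖D 0 b‖ + Σ_{j<k}Σ_c‖R j c‖)` — NO power of the number of levels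
`k` and no volume: the `ℓ¹` sizes of the initial field and of the sources simply ADD (`κ₁/ρ₁ = 318·d(d+2)·L^d`; at d = 3 the prefactor is `1 + 60L`).
[cite: Balaban1984PropagatorsI, (1.18)-(1.20) pp.19-20; Balaban1985Averaging, Prop. 3 (124)-(126) p.36] -/
theorem sum_norm_sourced_le_uniform (hd2 : 2 ≤ P.d) (a : ℕ → ℝ) (ha0 : ∀ j, 0 ≤ a j) {k : ℕ} (hk : k ≤ P.m + P.K)
    (hα : ∀ j < k, ∀ (c : PBond P (j + 1)) (i : Idx P),
        dist1 (loopHol (Averaging.iter (fun i => blockAvg (P := P) (j := i) (expMeanLogSU (n := n))) j U₀) c i) ≤ a j)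
    (ha24 : ∀ j < k, a j ≤ 1 / 24) (haN : ∀ j < k, a j < deltaSU n) :
    ∑ c : PBond P k, ‖D k c‖
      ≤ (1 + 4 * P.d * (((P.d + 2) * P.L : ℕ) : ℝ)) * Real.exp ((159 * (((P.d + 2) * P.L : ℕ) : ℝ) * (2 * P.d)) / (((P.L : ℝ) ^ P.d)⁻¹ * (P.L : ℝ)) * ∑ i ∈ Finset.range k, a i)
          * ((∑ b : PBond P 0, ‖D 0 b‖) + ∑ j ∈ Finset.range k, ∑ c : PBond P (j + 1), ‖R j c‖) := by
  have h := sum_norm_sourced_le U₀ R D hDs G hG0 hGs Λ hΛ0 hΛs a ha0 hk hα ha24 haN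
  have hLpos : (0 : ℝ) < (P.L : ℝ) := by exact_mod_cast P.L_pos
  have hL2 : (2 : ℝ) ≤ (P.L : ℝ) := by exact_mod_cast P.hL.2
  have hLdpos : (0 : ℝ) < (P.L : ℝ) ^ P.d := by positivity
  have hρ0 : (0 : ℝ) ≤ (((P.L : ℝ) ^ P.d)⁻¹ * (P.L : ℝ)) := by positivity
  have hρhalf : (((P.L : ℝ) ^ P.d)⁻¹ * (P.L : ℝ)) ≤ 1 / 2 := by
    have hLd : (P.L : ℝ) * P.L ≤ (P.L : ℝ) ^ P.d := by
      calc (P.L : ℝ) * P.L = (P.L : ℝ) ^ 2 := by ring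
        _ ≤ (P.L : ℝ) ^ P.d := pow_le_pow_right₀ (by linarith) hd2
    rw [← div_eq_inv_mul, div_le_iff₀ hLdpos]
    nlinarith
  have hκρ : (0 : ℝ) ≤ (159 * (((P.d + 2) * P.L : ℕ) : ℝ) * (2 * P.d)) / (((P.L : ℝ) ^ P.d)⁻¹ * (P.L : ℝ)) := by positivity
  have hE0 : ∀ j, 0 ≤ (fun j => Real.exp ((159 * (((P.d + 2) * P.L : ℕ) : ℝ) * (2 * P.d)) / (((P.L : ℝ) ^ P.d)⁻¹ * (P.L : ℝ)) * ∑ i ∈ Finset.range j, a i)) j := fun j => Real.exp_nonneg _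
  have hEmono : ∀ j k, j ≤ k → (fun j => Real.exp ((159 * (((P.d + 2) * P.L : ℕ) : ℝ) * (2 * P.d)) / (((P.L : ℝ) ^ P.d)⁻¹ * (P.L : ℝ)) * ∑ i ∈ Finset.range j, a i)) j ≤ (fun j => Real.exp ((159 * (((P.d + 2) * P.L : ℕ) : ℝ) * (2 * P.d)) / (((P.L : ℝ) ^ P.d)⁻¹ * (P.L : ℝ)) * ∑ i ∈ Finset.range j, a i)) k := fun j k hjk =>
    Real.exp_le_exp.2 (mul_le_mul_of_nonneg_left
      (Finset.sum_le_sum_of_subset_of_nonneg (Finset.range_mono hjk) (fun i _ _ => ha0 i)) hκρ)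
  have hC : (0 : ℝ) ≤ (((P.d + 2) * P.L : ℕ) : ℝ) := Nat.cast_nonneg _
  have hT : (0 : ℝ) ≤ 2 * P.d := by positivity
  have hg0 : 0 ≤ (∑ b : PBond P 0, ‖D 0 b‖) := Finset.sum_nonneg fun b _ => norm_nonneg _
  have hmain := geom_weights_uniform hρ0 hρhalf (fun j => Real.exp ((159 * (((P.d + 2) * P.L : ℕ) : ℝ) * (2 * P.d)) / (((P.L : ℝ) ^ P.d)⁻¹ * (P.L : ℝ)) * ∑ i ∈ Finset.range j, a i)) hE0 hEmono hC hT (∑ b : PBond P 0, ‖D 0 b‖) hg0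
    (fun j => ∑ c : PBond P (j + 1), ‖R j c‖) (fun j => Finset.sum_nonneg fun c _ => norm_nonneg _) k
  calc _ ≤ _ := h
    _ ≤ (1 + 2 * (2 * (P.d : ℝ)) * (((P.d + 2) * P.L : ℕ) : ℝ)) * Real.exp ((159 * (((P.d + 2) * P.L : ℕ) : ℝ) * (2 * P.d)) / (((P.L : ℝ) ^ P.d)⁻¹ * (P.L : ℝ)) * ∑ i ∈ Finset.range k, a i)
          * ((∑ b : PBond P 0, ‖D 0 b‖) + ∑ j ∈ Finset.range k, ∑ c : PBond P (j + 1), ‖R j c‖) := hmain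
    _ = _ := by ring

end Assembly

end Summit.QuantumFields.YangMills.Theorems.Prop7TrueLinSourcedDefectL1

end
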